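import Literature.Computability.Learning.OccamFiniteProofs
import Literature.Computability.Cryptography.StatisticalDistanceMixtures
import HarnessLib

/-!
# Occam's razor with samples from a nearby distribution

Layer `Literature/Computability/Learning`, theorems-only companion of `OccamFinite.lean` /
`OccamFiniteProofs.lean` (`occam_uniform_bound_holds`, `occam_finite_consistent_holds`: a
hypothesis of a finite class consistent with `m ≥ (1/ε)(ln |H| + ln (1/δ))` i.i.d. samples from `D`
has error `≤ ε` under `D` with probability `≥ 1 − δ`). When the learner can only sample from an
APPROXIMATION `D'` of the distribution `D` it is interested in — as in Aaronson–Chen 2017, proof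
of Lemma 8.2, where the query-register marginal `Q` is sampled through a `SampBPP` simulation
("Taking a polynomial number of samples from `Q`. This task is in `SampBQP` … by our assumption
… it can be done in `SampBPP`", p. 33, which is only `1/poly`-close to `Q`) — the guarantee
transfers with an additive loss of the statistical distance: the generalisation error of ANY
hypothesis moves by at most `Δ(D, D')` (`genError_le_add_tvDist`, from the event bound
`PMF.toReal_toOuterMeasure_sub_le_tvDist`), so

* `occamBadEvent_add_subset` — the bad event "consistent, yet `D`-error `> ε + Δ(D, D')`" is
  contained in the bad event "consistent, yet `D'`-error `> ε`";
* `occam_uniform_bound_nearby`, `occam_finite_consistent_nearby` — sampling from `D'`, with the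
  sample sizes of Occam's bound for accuracy `ε`, every consistent hypothesis of `H` has `D`-error
  `≤ ε + Δ(D, D')` with probability `≥ 1 − δ` (resp. the `|H|(1 − ε)^m` form).

## References

* M. Mohri, A. Rostamizadeh, A. Talwalkar, *Foundations of Machine Learning*, 2nd ed., MIT Press
  2018, Thm. 2.5 [MohriRostamizadehTalwalkar2018] (the exact-distribution bound).
* S. Aaronson, L. Chen, CCC 2017 (arXiv:1612.05903), proof of Lemma 8.2 (p. 33) [AaronsonChen2017]
  (the consumer: samples from a simulated marginal).
* O. Goldreich, *Foundations of Cryptography I*, CUP 2001, §3.8.4 Exercise 5 [Goldreich2001]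
  (`|p S − q S| ≤ Δ(p, q)`).
-/

noncomputable section

namespace Literature.Computability.Learning

open _root_.MeasureTheory

variable {X Y : Type}

/-- **The error of a hypothesis moves by at most the statistical distance of the distributions**:
`R_D(h) ≤ R_{D'}(h) + Δ(D, D')` (as real numbers). [cite: Goldreich2001, §3.8.4 Exercise 5] -/
theorem genError_le_add_tvDist (D D' : PMF X) (h c : X → Y) :
    (genError D h c).toReal ≤ (genError D' h c).toReal + D.tvDist D' := by
  have := PMF.toReal_toOuterMeasure_sub_le_tvDist D D' {x | h x ≠ c x}
  unfold genError
  linarith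

/-- The generalisation error is finite. [folklore] -/
theorem genError_ne_top (D : PMF X) (h c : X → Y) : genError D h c ≠ ⊤ :=
  ne_top_of_le_ne_top ENNReal.one_ne_top (genError_le_one D h c)

/-- **Bad events compare**: a hypothesis consistent with the sample whose `D`-error exceeds
`ε + Δ(D, D')` has `D'`-error exceeding `ε`; so the bad event for `(D, ε + Δ(D, D'))` lies inside the
bad event for `(D', ε)` (for `0 ≤ ε`). [cite: MohriRostamizadehTalwalkar2018, Thm. 2.5 (proof, the bad event)] -/
theorem occamBadEvent_add_subset (D D' : PMF X) (c : X → Y) (H : Finset (X → Y)) {ε : ℝ}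
    (hε : 0 ≤ ε) :
    occamBadEvent D c H (ε + D.tvDist D') ⊆ occamBadEvent D' c H ε := by
  rintro S ⟨h, hH, hcons, hbad⟩
  refine ⟨h, hH, hcons, ?_⟩
  have htv : 0 ≤ D.tvDist D' := PMF.tvDist_nonneg _ _
  have h1 : ε + D.tvDist D' < (genError D h c).toReal := by
    have := (ENNReal.ofReal_lt_iff_lt_toReal (by positivity) (genError_ne_top D h c)).1 hbad
    exact this
  have h2 := genError_le_add_tvDist D D' h c
  have h3 : ε < (genError D' h c).toReal := by linarith
  exact (ENNReal.ofReal_lt_iff_lt_toReal hε (genError_ne_top D' h c)).2 h3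

/-- **Occam's uniform bound with samples from a nearby distribution**: sampling `m` points i.i.d.
from `D'`, the probability that some hypothesis of `H` is consistent with the target on the sample
and yet has `D`-error `> ε + Δ(D, D')` is at most `|H|(1 − ε)^m` (`0 < ε ≤ 1`).
[cite: MohriRostamizadehTalwalkar2018, Thm. 2.5 (proof)] [cite: AaronsonChen2017, §8 (proof of Lemma 8.2, sampling Q through SampBPP, p. 33)] -/
theorem occam_uniform_bound_nearby (D D' : PMF X) (c : X → Y) (H : Finset (X → Y)) {ε : ℝ}
    (hε : 0 < ε) (hε1 : ε ≤ 1) (m : ℕ) :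
    (iidList D' m).toOuterMeasure (occamBadEvent D c H (ε + D.tvDist D')) ≤
      (H.card : ENNReal) * ENNReal.ofReal ((1 - ε) ^ m) :=
  (measure_mono (occamBadEvent_add_subset D D' c H hε.le)).trans
    (occam_uniform_bound_holds D' c H ε hε hε1 m)

/-- **Occam's razor (finite class, consistent case) with samples from a nearby distribution**:
with `m ≥ (1/ε)(ln |H| + ln (1/δ))` i.i.d. samples from `D'`, with probability `≥ 1 − δ` every
hypothesis of `H` consistent with the target on the sample has `D`-error `≤ ε + Δ(D, D')`.
[cite: MohriRostamizadehTalwalkar2018, Thm. 2.5] [cite: AaronsonChen2017, §8 (proof of Lemma 8.2, p. 33)] -/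
theorem occam_finite_consistent_nearby (D D' : PMF X) (c : X → Y) (H : Finset (X → Y)) {ε δ : ℝ}
    (hε : 0 < ε) (hε1 : ε ≤ 1) (hδ : 0 < δ) (m : ℕ)
    (hm : (1 / ε) * (Real.log H.card + Real.log (1 / δ)) ≤ m) :
    (iidList D' m).toOuterMeasure (occamBadEvent D c H (ε + D.tvDist D')) ≤ ENNReal.ofReal δ :=
  (measure_mono (occamBadEvent_add_subset D D' c H hε.le)).trans
    (occam_finite_consistent_holds D' c H ε δ hε hε1 hδ m hm)

end Literature.Computability.Learning

end
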